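import Literature.Probability.RandomPlanarGeometry.RestrictionConfigEvents
import Literature.Topology.PlaneTopology.ArgumentIncrement
import Literature.Topology.PlaneTopology.HalfPlaneArc
import HarnessLib

/-!
# The two sides of a configuration `K ∈ Ω` ([LSW] §2 "Fillings", §8.1): a crossing lemma

Level 3 of the decomposition of the named fact
`Literature.Probability.RandomPlanarGeometry.IsRestrictionMeasure.eq_five_eighths_of_outer_simple` (file `RestrictionMeasures`; plan in
`RestrictionMeasuresFiveEighths`): the planar topology behind the left filling `Fill₋` of a
two-sided configuration used in the proof of [LSW] Cor. 8.6, after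

* G. F. Lawler, O. Schramm, W. Werner, *Conformal restriction: the chordal case*, J. Amer. Math.
  Soc. **16** (2003) 917–955, arXiv:math/0209343 (**[LSW]**, arXiv page numbers): §2 p. 8
  "Fillings" ("`F^{ℝ₊}_ℍ(A)` denotes the union of `A` with the connected components of `ℍ̄ ∖ A`
  which do not intersect `[0, ∞)`" — the LEFT FILLING, written `Fill₋(A)` below), §8.1 p. 31
  ("we may obtain `P⁺_α` by applying `F^{ℝ₊}_ℍ` to a sample from the two sided restriction
  measure `P_α`") and the proof of Cor. 8.6 (p. 38: "the `P_α` probability that `i` ends up to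
  the 'right' of `K`").

For `K ∈ Ω` write `F = cl K = K ∪ {0}` and `F* = F ∪ conj(F)` (the mirror-symmetrised
closure, a closed connected unbounded set meeting `ℝ` exactly at `0`). All PROVED:

* `Literature.RestrictionConfig.rightDomain K` — the connected component of `1` in `ℂ ∖ F*` (open,
  connected, symmetric under complex conjugation, containing the positive real axis); its trace
  on the closed upper half-plane is the component of `ℍ̄ ∖ F` meeting `[0, ∞)`
  (`rightDomain_inter_eq`: a path in `ℂ ∖ F*` folds up into `ℍ̄ ∖ F`, `foldUp` of
  `HalfPlaneArc`), so that `Fill₋(F) = ℍ̄ ∖ rightDomain K` — the definition of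
  `RestrictionConfig.leftFill` below; symmetrically `leftDomain K`, the component of `−1`;
* `Literature.Probability.RandomPlanarGeometry.RestrictionConfig.neg_one_notMem_rightDomain` — **crossing lemma**: `−1 ∉ rightDomain K`,
  i.e. `K` separates the negative from the positive real axis inside `ℍ̄`. Proof: a path from
  `1` to `−1` in `ℂ ∖ F*` folds up to a path `p` in `ℍ̄ ∖ F`; the loop `L = p · conj(p⁻¹)`
  misses `F` and has winding number `1` about `0` (the argument increases by `π` along each
  half: rotate by `∓i` into the slit plane and use the principal logarithm,
  `logInc_eq_log_sub_log` of `ArgumentIncrement`); winding numbers are constant on the connected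
  set `F ∋ 0` missing `L` (`wind_sub_eq_of_mem_connectedComponentIn`, Eilenberg), but vanish
  at points of the unbounded `F` outside a disc containing `L` — contradiction;
* consequences: `rightDomain K ∩ leftDomain K = ∅`, the negative real axis misses
  `rightDomain K`, and `leftFill K ∩ ℝ = (−∞, 0]` (`leftFill_inter_range_ofReal`), with
  `cl K ⊆ leftFill K ⊆ ℍ̄`, `leftFill K` closed.

Mathlib: `connectedComponentIn`, `IsOpen.connectedComponentIn`,
`IsOpen.isConnected_iff_isPathConnected`, `Homeomorph.image_connectedComponentIn`,
`Complex.slitPlane`, `Complex.log_I`, `Complex.log_neg_I`. Tree: `Literature.Topology.PlaneTopology.wind`, `Literature.Topology.PlaneTopology.logInc`,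
`Path.argInc` (`WindingNumber`, `ArgumentIncrement`), `Literature.Topology.PlaneTopology.foldUp` (`HalfPlaneArc`).
-/

noncomputable section

open Set Filter Topology Metric Bornology Complex
open UpperHalfPlane (upperHalfPlaneSet)
open scoped Real NNReal ComplexConjugate

namespace Literature.Probability.RandomPlanarGeometry

/-! ### Winding lemmas for the crossing lemma -/

/-- `−i w` lies in the slit plane for `w ≠ 0` in the closed upper half-plane. [folklore] -/
theorem neg_I_mul_mem_slitPlane {w : ℂ} (hw : 0 ≤ w.im) (hw0 : w ≠ 0) : -I * w ∈ slitPlane := by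
  rw [Complex.mem_slitPlane_iff]
  have hre : (-I * w).re = w.im := by simp
  have him : (-I * w).im = -w.re := by simp
  rw [hre, him]
  rcases hw.lt_or_eq with h | h
  · exact Or.inl h
  · right
    intro h0
    apply hw0
    exact Complex.ext (by simpa using h0) (by simp [← h])

/-- `i w` lies in the slit plane for `w ≠ 0` in the closed lower half-plane. [folklore] -/
theorem I_mul_mem_slitPlane {w : ℂ} (hw : w.im ≤ 0) (hw0 : w ≠ 0) : I * w ∈ slitPlane := by
  rw [Complex.mem_slitPlane_iff]
  have hre : (I * w).re = -w.im := by simp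
  have him : (I * w).im = w.re := by simp
  rw [hre, him]
  rcases hw.lt_or_eq with h | h
  · exact Or.inl (by linarith)
  · right
    intro h0
    apply hw0
    exact Complex.ext (by simpa using h0) (by simp [h])

/-- The increment of the logarithm is unchanged by a nonzero constant factor. [folklore] -/
theorem logInc_const_mul {c : ℂ} (hc : c ≠ 0) {f : ℝ → ℂ} (hf : Literature.Topology.PlaneTopology.HasLogOn f (Icc 0 1)) :
    Literature.Topology.PlaneTopology.logInc (fun t ↦ c * f t) = Literature.Topology.PlaneTopology.logInc f := by
  rw [Literature.Topology.PlaneTopology.logInc_mul (Literature.Topology.PlaneTopology.hasLogOn_const hc _) hf, Literature.Topology.PlaneTopology.logInc_const, zero_add]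

/-- **Half a turn above**: along a path from `1` to `−1` in the closed upper half-plane
avoiding `0`, the argument of `z` increases by `π` (`logInc = πi`). [folklore] -/
theorem argInc_eq_pi_of_im_nonneg (p : Path (1 : ℂ) (-1)) (him : ∀ t, 0 ≤ (p t).im)
    (h0 : ∀ t, p t ≠ 0) : p.argInc 0 = π * I := by
  unfold Path.argInc
  have hext : ∀ t : ℝ, 0 ≤ (p.extend t).im ∧ p.extend t ≠ 0 := fun t ↦ by
    rw [Path.extend]
    exact ⟨him _, h0 _⟩
  have hlog : Literature.Topology.PlaneTopology.HasLogOn (fun t ↦ p.extend t - 0) (Icc 0 1) :=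
    Literature.Topology.PlaneTopology.hasLogOn_Icc (p.continuous_extend.continuousOn.sub continuousOn_const)
      fun t _ ↦ by rw [sub_zero]; exact (hext t).2
  have hfun : (fun t ↦ p.extend t - 0) = fun t ↦ I * (-I * p.extend t) := by
    funext t
    rw [sub_zero, ← mul_assoc]
    simp
  have hlog' : Literature.Topology.PlaneTopology.HasLogOn (fun t ↦ -I * p.extend t) (Icc 0 1) :=
    ((Literature.Topology.PlaneTopology.hasLogOn_const (show (-I : ℂ) ≠ 0 by simp) (Icc (0 : ℝ) 1)).mul hlog).congr
      fun t _ ↦ by simp only [sub_zero]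
  rw [hfun, logInc_const_mul I_ne_zero hlog',
    Literature.Topology.PlaneTopology.logInc_eq_log_sub_log (f := fun t ↦ -I * p.extend t)
      (continuousOn_const.mul p.continuous_extend.continuousOn)
      fun t _ ↦ neg_I_mul_mem_slitPlane (hext t).1 (hext t).2]
  simp only [Path.extend_one, Path.extend_zero, mul_neg, mul_one, neg_neg]
  rw [Complex.log_I, Complex.log_neg_I]
  ring

/-- **Half a turn below**: along a path from `−1` to `1` in the closed lower half-plane
avoiding `0`, the argument of `z` increases by `π`. [folklore] -/
theorem argInc_eq_pi_of_im_nonpos (p : Path (-1 : ℂ) 1) (him : ∀ t, (p t).im ≤ 0)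
    (h0 : ∀ t, p t ≠ 0) : p.argInc 0 = π * I := by
  unfold Path.argInc
  have hext : ∀ t : ℝ, (p.extend t).im ≤ 0 ∧ p.extend t ≠ 0 := fun t ↦ by
    rw [Path.extend]
    exact ⟨him _, h0 _⟩
  have hlog : Literature.Topology.PlaneTopology.HasLogOn (fun t ↦ p.extend t - 0) (Icc 0 1) :=
    Literature.Topology.PlaneTopology.hasLogOn_Icc (p.continuous_extend.continuousOn.sub continuousOn_const)
      fun t _ ↦ by rw [sub_zero]; exact (hext t).2
  have hfun : (fun t ↦ p.extend t - 0) = fun t ↦ -I * (I * p.extend t) := by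
    funext t
    rw [sub_zero, ← mul_assoc]
    simp
  have hlog' : Literature.Topology.PlaneTopology.HasLogOn (fun t ↦ I * p.extend t) (Icc 0 1) :=
    ((Literature.Topology.PlaneTopology.hasLogOn_const I_ne_zero (Icc (0 : ℝ) 1)).mul hlog).congr fun t _ ↦ by simp only [sub_zero]
  rw [hfun, logInc_const_mul (show (-I : ℂ) ≠ 0 by simp) hlog',
    Literature.Topology.PlaneTopology.logInc_eq_log_sub_log (f := fun t ↦ I * p.extend t)
      (continuousOn_const.mul p.continuous_extend.continuousOn)
      fun t _ ↦ I_mul_mem_slitPlane (hext t).1 (hext t).2]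
  simp only [Path.extend_one, Path.extend_zero, mul_neg, mul_one]
  rw [Complex.log_I, Complex.log_neg_I]
  ring

/-- `z − f` has a continuous logarithm on the closed disc `|z| ≤ R` when `|f| > R`
(`z − f = −f (1 − z/f)` with `|z/f| < 1`). [folklore] -/
theorem hasLogOn_sub_of_lt_norm {R : ℝ} (hR : 0 ≤ R) {f : ℂ} (hf : R < ‖f‖) :
    Literature.Topology.PlaneTopology.HasLogOn (fun z : ℂ ↦ z - f) (closedBall 0 R) := by
  have hf0 : f ≠ 0 := by
    rintro rfl
    rw [norm_zero] at hf
    exact absurd hf (not_lt.2 hR)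
  have hslit : ∀ z ∈ closedBall (0 : ℂ) R, 1 + -(z / f) ∈ slitPlane := fun z hz ↦ by
    refine Complex.mem_slitPlane_of_norm_lt_one ?_
    rw [norm_neg, norm_div, div_lt_one (norm_pos_iff.2 hf0)]
    rw [mem_closedBall, dist_zero_right] at hz
    exact hz.trans_lt hf
  refine ⟨fun z ↦ log (-f) + log (1 + -(z / f)), ?_, fun z hz ↦ ?_⟩
  · refine continuousOn_const.add (ContinuousOn.clog (by fun_prop) hslit)
  · rw [Complex.exp_add, Complex.exp_log (neg_ne_zero.2 hf0),
      Complex.exp_log (slitPlane_ne_zero (hslit z hz))]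
    field_simp
    ring

namespace RestrictionConfig

variable (K : RestrictionConfig)

/-! ### The closure `F = K ∪ {0}` and its mirror double `F* = F ∪ conj F` -/

/-- `cl K = K ∪ {0}`. [folklore] -/
theorem closure_eq : closure (K : Set ℂ) = (K : Set ℂ) ∪ {0} :=
  Subset.antisymm K.closure_subset
    (union_subset subset_closure (singleton_subset_iff.2 K.zero_mem_closure))

/-- The closure of a configuration is connected. [folklore] -/
theorem isConnected_closure : IsConnected (closure (K : Set ℂ)) :=
  K.isConnected.closure

/-- A real point of `cl K` is `0`. [folklore] -/
theorem eq_zero_of_mem_closure_of_im_eq_zero {z : ℂ} (hz : z ∈ closure (K : Set ℂ))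
    (him : z.im = 0) : z = 0 := by
  have : z ∈ closure (K : Set ℂ) ∩ range ((↑) : ℝ → ℂ) :=
    ⟨hz, ⟨z.re, Complex.ext (by simp) (by simp [him])⟩⟩
  rw [K.closure_inter_range_ofReal] at this
  exact this

/-- **The mirror double `F* = cl K ∪ conj(cl K)`** of the closure of a configuration: a closed
set, symmetric under complex conjugation. [folklore] -/
def mirrorClosure : Set ℂ := closure (K : Set ℂ) ∪ conj ⁻¹' closure (K : Set ℂ)

/-- `F*` is closed. [folklore] -/
theorem isClosed_mirrorClosure : IsClosed K.mirrorClosure :=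
  isClosed_closure.union (isClosed_closure.preimage Complex.continuous_conj)

/-- `F*` is symmetric under conjugation. [folklore] -/
theorem conj_mem_mirrorClosure_iff {z : ℂ} : conj z ∈ K.mirrorClosure ↔ z ∈ K.mirrorClosure := by
  simp only [mirrorClosure, mem_union, mem_preimage, Complex.conj_conj]
  tauto

/-- `cl K ⊆ F*`. [folklore] -/
theorem closure_subset_mirrorClosure : closure (K : Set ℂ) ⊆ K.mirrorClosure :=
  subset_union_left

/-- `0 ∈ F*`. [folklore] -/
theorem zero_mem_mirrorClosure : (0 : ℂ) ∈ K.mirrorClosure :=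
  K.closure_subset_mirrorClosure K.zero_mem_closure

/-- In the closed upper half-plane, `F*` is just `cl K` (`conj(cl K)` meets `ℍ̄` only at `0`). [folklore] -/
theorem mem_mirrorClosure_iff_of_im_nonneg {z : ℂ} (hz : 0 ≤ z.im) :
    z ∈ K.mirrorClosure ↔ z ∈ closure (K : Set ℂ) := by
  refine ⟨fun h ↦ h.elim id fun h' ↦ ?_, fun h ↦ Or.inl h⟩
  -- `conj z ∈ cl K ⊆ {Im ≥ 0}` forces `Im z = 0`, so `conj z = z`
  have h1 : 0 ≤ (conj z).im := K.closure_subset_setOf_im_nonneg h'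
  rw [Complex.conj_im] at h1
  have him : z.im = 0 := le_antisymm (by linarith) hz
  have hcz : conj z = z := Complex.ext (by simp) (by simp [him])
  have h'' : conj z ∈ closure (K : Set ℂ) := h'
  rwa [hcz] at h''

/-- A real point of `F*` is `0`. [folklore] -/
theorem eq_zero_of_mem_mirrorClosure_of_im_eq_zero {z : ℂ} (hz : z ∈ K.mirrorClosure)
    (him : z.im = 0) : z = 0 :=
  K.eq_zero_of_mem_closure_of_im_eq_zero ((K.mem_mirrorClosure_iff_of_im_nonneg him.ge).1 hz) him

/-- Nonzero reals are off `F*`. [folklore] -/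
theorem ofReal_notMem_mirrorClosure {x : ℝ} (hx : x ≠ 0) : (x : ℂ) ∉ K.mirrorClosure := fun h ↦
  hx (by exact_mod_cast K.eq_zero_of_mem_mirrorClosure_of_im_eq_zero h (Complex.ofReal_im x))

/-- The fold `z ↦ Re z + i|Im z|` maps `ℂ ∖ F*` into `ℍ̄ ∖ cl K`. [folklore] -/
theorem foldUp_notMem_closure {z : ℂ} (hz : z ∉ K.mirrorClosure) : Literature.Topology.PlaneTopology.foldUp z ∉ closure (K : Set ℂ) := by
  intro h
  rcases Literature.Topology.PlaneTopology.foldUp_eq_or z with h' | h'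
  · exact hz (Or.inl (h' ▸ h))
  · exact hz (Or.inr (show conj z ∈ _ from h' ▸ h))

/-! ### The right and left domains -/

/-- **The right domain of `K`**: the connected component of `1` in `ℂ ∖ F*`. Its trace on `ℍ̄`
is the component of `ℍ̄ ∖ cl K` meeting `[0, ∞)` (`rightDomain_inter_eq`), whose complement
in `ℍ̄` is [LSW]'s left filling `F^{ℝ₊}_ℍ(cl K)` (§2 p. 8). [cite: LawlerSchrammWerner2003Restriction, §2 p. 8 (Fillings, F^{ℝ₊}_ℍ)] -/
def rightDomain : Set ℂ := connectedComponentIn K.mirrorClosureᶜ 1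

/-- **The left domain of `K`**: the connected component of `−1` in `ℂ ∖ F*` (the mirror
notion, `Fill₊`). [cite: LawlerSchrammWerner2003Restriction, §2 p. 8 (Fillings)] -/
def leftDomain : Set ℂ := connectedComponentIn K.mirrorClosureᶜ (-1)

/-- `1 ∉ F*`. [folklore] -/
theorem one_notMem_mirrorClosure : (1 : ℂ) ∉ K.mirrorClosure := by
  exact_mod_cast K.ofReal_notMem_mirrorClosure one_ne_zero

/-- `−1 ∉ F*`. [folklore] -/
theorem neg_one_notMem_mirrorClosure : (-1 : ℂ) ∉ K.mirrorClosure := by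
  have := K.ofReal_notMem_mirrorClosure (x := -1) (by norm_num)
  simpa using this

/-- `1 ∈ rightDomain K`. [folklore] -/
theorem one_mem_rightDomain : (1 : ℂ) ∈ K.rightDomain :=
  mem_connectedComponentIn K.one_notMem_mirrorClosure

/-- `−1 ∈ leftDomain K`. [folklore] -/
theorem neg_one_mem_leftDomain : (-1 : ℂ) ∈ K.leftDomain :=
  mem_connectedComponentIn K.neg_one_notMem_mirrorClosure

/-- The right domain misses `F*`. [folklore] -/
theorem rightDomain_subset_compl : K.rightDomain ⊆ K.mirrorClosureᶜ :=
  connectedComponentIn_subset _ _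

/-- The left domain misses `F*`. [folklore] -/
theorem leftDomain_subset_compl : K.leftDomain ⊆ K.mirrorClosureᶜ :=
  connectedComponentIn_subset _ _

/-- The right domain is open. [folklore] -/
theorem isOpen_rightDomain : IsOpen K.rightDomain :=
  K.isClosed_mirrorClosure.isOpen_compl.connectedComponentIn

/-- The left domain is open. [folklore] -/
theorem isOpen_leftDomain : IsOpen K.leftDomain :=
  K.isClosed_mirrorClosure.isOpen_compl.connectedComponentIn

/-- The right domain is connected. [folklore] -/
theorem isConnected_rightDomain : IsConnected K.rightDomain :=
  ⟨⟨1, K.one_mem_rightDomain⟩, isPreconnected_connectedComponentIn⟩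

/-- The left domain is connected. [folklore] -/
theorem isConnected_leftDomain : IsConnected K.leftDomain :=
  ⟨⟨-1, K.neg_one_mem_leftDomain⟩, isPreconnected_connectedComponentIn⟩

/-- **The positive real axis lies in the right domain** (it is connected, off `F*`, through `1`). [folklore] -/
theorem ofReal_mem_rightDomain {x : ℝ} (hx : 0 < x) : (x : ℂ) ∈ K.rightDomain := by
  have hsub : ((↑) : ℝ → ℂ) '' Ioi 0 ⊆ K.mirrorClosureᶜ := by
    rintro _ ⟨y, hy, rfl⟩
    exact K.ofReal_notMem_mirrorClosure (ne_of_gt hy)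
  have hconn : IsPreconnected (((↑) : ℝ → ℂ) '' Ioi 0) :=
    isPreconnected_Ioi.image _ Complex.continuous_ofReal.continuousOn
  have h1 : (1 : ℂ) ∈ ((↑) : ℝ → ℂ) '' Ioi 0 := ⟨1, mem_Ioi.2 zero_lt_one, by simp⟩
  exact (hconn.subset_connectedComponentIn h1 hsub) ⟨x, hx, rfl⟩

/-- **The negative real axis lies in the left domain.** [folklore] -/
theorem ofReal_mem_leftDomain {x : ℝ} (hx : x < 0) : (x : ℂ) ∈ K.leftDomain := by
  have hsub : ((↑) : ℝ → ℂ) '' Iio 0 ⊆ K.mirrorClosureᶜ := by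
    rintro _ ⟨y, hy, rfl⟩
    exact K.ofReal_notMem_mirrorClosure (ne_of_lt hy)
  have hconn : IsPreconnected (((↑) : ℝ → ℂ) '' Iio 0) :=
    isPreconnected_Iio.image _ Complex.continuous_ofReal.continuousOn
  have h1 : (-1 : ℂ) ∈ ((↑) : ℝ → ℂ) '' Iio 0 := ⟨-1, mem_Iio.2 (by norm_num), by simp⟩
  exact (hconn.subset_connectedComponentIn h1 hsub) ⟨x, hx, rfl⟩

/-- **The right domain is symmetric under conjugation** (`conj` is a homeomorphism preserving
`F*` and fixing `1`). [folklore] -/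
theorem conj_mem_rightDomain_iff {z : ℂ} : conj z ∈ K.rightDomain ↔ z ∈ K.rightDomain := by
  have key : ∀ w : ℂ, w ∈ K.rightDomain → conj w ∈ K.rightDomain := fun w hw ↦ by
    have himg := Complex.conjCLE.toHomeomorph.image_connectedComponentIn
      (s := K.mirrorClosureᶜ) (x := 1) K.one_notMem_mirrorClosure
    have hs : Complex.conjCLE.toHomeomorph '' K.mirrorClosureᶜ = K.mirrorClosureᶜ := by
      ext u
      simp only [mem_image, mem_compl_iff]
      constructor
      · rintro ⟨v, hv, rfl⟩
        change conj v ∉ _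
        rwa [K.conj_mem_mirrorClosure_iff]
      · intro hu
        refine ⟨conj u, by rwa [K.conj_mem_mirrorClosure_iff], ?_⟩
        change conj (conj u) = u
        exact Complex.conj_conj u
    have h1 : Complex.conjCLE.toHomeomorph (1 : ℂ) = 1 := by
      change conj (1 : ℂ) = 1
      exact map_one _
    rw [hs, h1] at himg
    change conj '' K.rightDomain = K.rightDomain at himg
    rw [← himg]
    exact ⟨w, hw, rfl⟩
  refine ⟨fun h ↦ ?_, key z⟩
  simpa using key _ h

/-! ### The crossing lemma -/

/-- **Crossing lemma.** For `K ∈ Ω`, the point `−1` is not in the right domain: `K` (closed up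
at `0`, connected and running off to `∞` inside `ℍ ∪ {0}`) separates the negative from the
positive real axis in `ℍ̄`. See the module docstring for the winding-number proof. [folklore] -/
theorem neg_one_notMem_rightDomain : (-1 : ℂ) ∉ K.rightDomain := by
  intro hneg
  set F : Set ℂ := closure (K : Set ℂ) with hF
  -- a path from `1` to `-1` off `F*`, folded up into `ℍ̄ ∖ F`
  have hO : IsOpen K.mirrorClosureᶜ := K.isClosed_mirrorClosure.isOpen_compl
  have hpath : IsPathConnected K.rightDomain :=
    K.isOpen_rightDomain.isConnected_iff_isPathConnected.1 K.isConnected_rightDomain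
  obtain ⟨q, hq⟩ := hpath.joinedIn 1 K.one_mem_rightDomain (-1) hneg
  have hqF : ∀ t, q t ∉ K.mirrorClosure := fun t ↦ K.rightDomain_subset_compl (hq t)
  let p : Path (1 : ℂ) (-1) :=
    { toFun := fun t ↦ Literature.Topology.PlaneTopology.foldUp (q t)
      continuous_toFun := Literature.Topology.PlaneTopology.continuous_foldUp.comp q.continuous
      source' := by simp [Literature.Topology.PlaneTopology.foldUp_of_nonneg]
      target' := by simp [Literature.Topology.PlaneTopology.foldUp_of_nonneg] }
  have hp_im : ∀ t, 0 ≤ (p t).im := fun t ↦ by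
    show 0 ≤ (Literature.Topology.PlaneTopology.foldUp (q t)).im
    rw [Literature.Topology.PlaneTopology.foldUp_im]
    exact abs_nonneg _
  have hp_F : ∀ t, p t ∉ F := fun t ↦ K.foldUp_notMem_closure (hqF t)
  have hp_0 : ∀ t, p t ≠ 0 := fun t h ↦ hp_F t (h ▸ K.zero_mem_closure)
  -- the mirror path from `-1` back to `1`, below the axis
  let p₂ : Path (-1 : ℂ) 1 :=
    { toFun := fun t ↦ conj (p.symm t)
      continuous_toFun := Complex.continuous_conj.comp p.symm.continuous
      source' := by simp
      target' := by simp }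
  have hp₂_im : ∀ t, (p₂ t).im ≤ 0 := fun t ↦ by
    change (conj (p (unitInterval.symm t))).im ≤ 0
    rw [Complex.conj_im, neg_nonpos]
    exact hp_im _
  have hp₂_F : ∀ t, p₂ t ∉ F := fun t h ↦ by
    -- `conj (p s) ∈ F ⊆ {Im ≥ 0}` forces it real, hence equal to `p s ∈ F`
    change conj (p (unitInterval.symm t)) ∈ F at h
    set w : ℂ := p (unitInterval.symm t) with hw
    have h1 : 0 ≤ (conj w).im := K.closure_subset_setOf_im_nonneg h
    rw [Complex.conj_im] at h1
    have him : w.im = 0 := le_antisymm (by linarith) (hp_im _)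
    have hcw : conj w = w := Complex.ext (by simp) (by simp [him])
    rw [hcw] at h
    exact hp_F _ h
  have hp₂_0 : ∀ t, p₂ t ≠ 0 := fun t h ↦ hp₂_F t (h ▸ K.zero_mem_closure)
  -- the loop and its winding number about `0`
  let L : Path (1 : ℂ) 1 := p.trans p₂
  have h0p : (0 : ℂ) ∉ range p := fun ⟨t, ht⟩ ↦ hp_0 t ht
  have h0p₂ : (0 : ℂ) ∉ range p₂ := fun ⟨t, ht⟩ ↦ hp₂_0 t ht
  have h0L : (0 : ℂ) ∉ range L := by
    rw [Path.trans_range]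
    rintro (h | h)
    exacts [h0p h, h0p₂ h]
  have hLF : Disjoint (range L) F := by
    rw [Path.trans_range, Set.disjoint_left]
    rintro _ (⟨t, rfl⟩ | ⟨t, rfl⟩)
    exacts [hp_F t, hp₂_F t]
  have hwind1 : Literature.Topology.PlaneTopology.wind (fun t ↦ L.extend t - 0) = 1 := by
    have h := L.argInc_eq_wind_mul h0L
    rw [Path.argInc_trans p p₂ h0p h0p₂, argInc_eq_pi_of_im_nonneg p hp_im hp_0,
      argInc_eq_pi_of_im_nonpos p₂ hp₂_im hp₂_0] at h
    have h' : ((1 : ℤ) : ℂ) * (2 * π * I) = (Literature.Topology.PlaneTopology.wind fun t ↦ L.extend t - 0) * (2 * π * I) := by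
      rw [← h]
      push_cast
      ring
    exact (Literature.Topology.PlaneTopology.int_eq_of_mul_two_pi_I_eq h').symm
  -- `F` lies in the component of `0` off the loop
  have hFcomp : F ⊆ connectedComponentIn (range L)ᶜ 0 :=
    K.isConnected_closure.isPreconnected.subset_connectedComponentIn K.zero_mem_closure
      (Set.disjoint_left.1 hLF.symm)
  -- a far point of `K`
  obtain ⟨R, hR⟩ := (isCompact_range L.continuous).isBounded.subset_closedBall 0
  obtain ⟨f, hfK, hfR⟩ : ∃ f ∈ (K : Set ℂ), f ∉ closedBall (0 : ℂ) (max R 0) := by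
    by_contra hcon
    push Not at hcon
    exact K.not_isBounded ((isBounded_closedBall).subset hcon)
  rw [mem_closedBall, dist_zero_right, not_le] at hfR
  have hfcomp : f ∈ connectedComponentIn (range L)ᶜ 0 := hFcomp (subset_closure hfK)
  -- winding numbers about `0` and about `f` agree, but the latter vanishes
  have hmaps : MapsTo L.extend (Icc 0 1) (range L) := fun t ht ↦ by
    rw [Path.extend_apply L ht]
    exact mem_range_self _
  have heq := Literature.Topology.PlaneTopology.wind_sub_eq_of_mem_connectedComponentIn L.continuous_extend.continuousOn
    (by simp) (isCompact_range L.continuous).isClosed hmaps hfcomp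
  have hzero : Literature.Topology.PlaneTopology.wind (fun t ↦ L.extend t - f) = 0 := by
    have hlog := hasLogOn_sub_of_lt_norm (le_max_right R 0) hfR
    have hmaps' : MapsTo L.extend (Icc 0 1) (closedBall 0 (max R 0)) := fun t ht ↦
      (closedBall_subset_closedBall (le_max_left _ _)) (hR (hmaps ht))
    exact Literature.Topology.PlaneTopology.wind_comp_eq_zero_of_hasLogOn hlog L.continuous_extend.continuousOn hmaps' (by simp)
  rw [hwind1, hzero] at heq
  exact one_ne_zero heq

/-- **The two domains are disjoint** (they are components of `ℂ ∖ F*`, and differ by the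
crossing lemma). [folklore] -/
theorem disjoint_rightDomain_leftDomain : Disjoint K.rightDomain K.leftDomain := by
  rw [Set.disjoint_left]
  intro z hzr hzl
  apply K.neg_one_notMem_rightDomain
  have h1 : K.rightDomain = connectedComponentIn K.mirrorClosureᶜ z := connectedComponentIn_eq hzr
  have h2 : K.leftDomain = connectedComponentIn K.mirrorClosureᶜ z := connectedComponentIn_eq hzl
  rw [h1, ← h2]
  exact K.neg_one_mem_leftDomain

/-- The negative real axis misses the right domain. [folklore] -/
theorem ofReal_notMem_rightDomain {x : ℝ} (hx : x ≤ 0) : (x : ℂ) ∉ K.rightDomain := by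
  rcases hx.lt_or_eq with h | rfl
  · exact fun h' ↦ Set.disjoint_left.1 K.disjoint_rightDomain_leftDomain h' (K.ofReal_mem_leftDomain h)
  · exact fun h' ↦ K.rightDomain_subset_compl h' (by exact_mod_cast K.zero_mem_mirrorClosure)

/-- The positive real axis misses the left domain. [folklore] -/
theorem ofReal_notMem_leftDomain {x : ℝ} (hx : 0 ≤ x) : (x : ℂ) ∉ K.leftDomain := by
  rcases hx.lt_or_eq with h | rfl
  · exact fun h' ↦ Set.disjoint_left.1 K.disjoint_rightDomain_leftDomain (K.ofReal_mem_rightDomain h) h'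
  · exact fun h' ↦ K.leftDomain_subset_compl h' (by exact_mod_cast K.zero_mem_mirrorClosure)

/-! ### The left filling `Fill₋(cl K)` -/

/-- **The left filling of a configuration** ([LSW] §2 p. 8: "`F^{ℝ₊}_ℍ(A)` denotes the union
of `A` with the connected components of `ℍ̄ ∖ A` which do not intersect `[0, ∞)`", applied to
`A = cl K`; §8.1 p. 31: `F^{ℝ₊}_ℍ` of a sample of `P_α` is a sample of `P⁺_α`): the closed
upper half-plane minus the right domain. Since `[0, ∞) ∖ cl K = (0, ∞)` is connected, exactly one
component of `ℍ̄ ∖ cl K` meets `[0, ∞)`, namely `rightDomain K ∩ ℍ̄` (`rightDomain_inter_eq`),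
so this is [LSW]'s `Fill₋(cl K)`. [cite: LawlerSchrammWerner2003Restriction, §2 p. 8 (Fillings, F^{ℝ₊}_ℍ) and §8.1 p. 31] -/
def leftFill : Set ℂ := {z : ℂ | 0 ≤ z.im} \ K.rightDomain

/-- The left filling lies in the closed upper half-plane. [folklore] -/
theorem leftFill_subset : K.leftFill ⊆ {z : ℂ | 0 ≤ z.im} := fun _ h ↦ h.1

/-- The left filling is closed. [folklore] -/
theorem isClosed_leftFill : IsClosed K.leftFill :=
  (isClosed_le continuous_const Complex.continuous_im).sdiff K.isOpen_rightDomain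

/-- `cl K ⊆ Fill₋(cl K)`. [folklore] -/
theorem closure_subset_leftFill : closure (K : Set ℂ) ⊆ K.leftFill := fun _ hz ↦
  ⟨K.closure_subset_setOf_im_nonneg hz, fun h ↦ K.rightDomain_subset_compl h (Or.inl hz)⟩

/-- `K ⊆ Fill₋(cl K)`. [folklore] -/
theorem subset_leftFill : (K : Set ℂ) ⊆ K.leftFill :=
  subset_closure.trans K.closure_subset_leftFill

/-- **`Fill₋(cl K) ∩ ℝ = (−∞, 0]`**: positive reals are in the right domain, nonpositive ones
are not (crossing lemma). [cite: LawlerSchrammWerner2003Restriction, §8.1 p. 31 (K ∩ ℝ = (−∞, 0] for K ∈ Ω₊)] -/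
theorem ofReal_mem_leftFill_iff {x : ℝ} : (x : ℂ) ∈ K.leftFill ↔ x ≤ 0 := by
  constructor
  · rintro ⟨-, hx⟩
    by_contra h
    exact hx (K.ofReal_mem_rightDomain (not_le.1 h))
  · intro hx
    exact ⟨by simp, K.ofReal_notMem_rightDomain hx⟩

/-- `Fill₋(cl K) ∩ ℝ = (−∞, 0]` as sets. [cite: LawlerSchrammWerner2003Restriction, §8.1 p. 31] -/
theorem leftFill_inter_range_ofReal :
    K.leftFill ∩ range ((↑) : ℝ → ℂ) = ((↑) : ℝ → ℂ) '' Iic 0 := by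
  ext z
  constructor
  · rintro ⟨hz, ⟨x, rfl⟩⟩
    exact ⟨x, K.ofReal_mem_leftFill_iff.1 hz, rfl⟩
  · rintro ⟨x, hx, rfl⟩
    exact ⟨K.ofReal_mem_leftFill_iff.2 hx, ⟨x, rfl⟩⟩

/-- **The trace of the right domain on `ℍ̄` is the component of `1` in `ℍ̄ ∖ cl K`**: a point of
`ℍ̄` joined to `1` off `F*` is joined to `1` inside `ℍ̄ ∖ cl K` by the folded path, and a
connected subset of `ℍ̄ ∖ cl K` through `1` misses `F*`. Hence `leftFill K` is literally
[LSW]'s `Fill₋(cl K)`. [cite: LawlerSchrammWerner2003Restriction, §2 p. 8 (Fillings)] -/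
theorem rightDomain_inter_eq :
    K.rightDomain ∩ {z : ℂ | 0 ≤ z.im} = connectedComponentIn ({z : ℂ | 0 ≤ z.im} \ closure K) 1 := by
  refine Subset.antisymm ?_ ?_
  · rintro z ⟨hz, hzim⟩
    have hpath : IsPathConnected K.rightDomain :=
      K.isOpen_rightDomain.isConnected_iff_isPathConnected.1 K.isConnected_rightDomain
    obtain ⟨q, hq⟩ := hpath.joinedIn 1 K.one_mem_rightDomain z hz
    -- the folded path joins `1` to `z` in `ℍ̄ ∖ cl K`
    have hsub : range (fun t ↦ Literature.Topology.PlaneTopology.foldUp (q t)) ⊆ {z : ℂ | 0 ≤ z.im} \ closure K := by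
      rintro _ ⟨t, rfl⟩
      exact ⟨by rw [mem_setOf_eq, Literature.Topology.PlaneTopology.foldUp_im]; exact abs_nonneg _,
        K.foldUp_notMem_closure (K.rightDomain_subset_compl (hq t))⟩
    have hconn : IsPreconnected (range fun t ↦ Literature.Topology.PlaneTopology.foldUp (q t)) :=
      (isConnected_range (Literature.Topology.PlaneTopology.continuous_foldUp.comp q.continuous)).isPreconnected
    have h1 : (1 : ℂ) ∈ range fun t ↦ Literature.Topology.PlaneTopology.foldUp (q t) := ⟨0, by simp [Literature.Topology.PlaneTopology.foldUp_of_nonneg]⟩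
    have hz' : z ∈ range fun t ↦ Literature.Topology.PlaneTopology.foldUp (q t) := ⟨1, by simp [Literature.Topology.PlaneTopology.foldUp_of_nonneg hzim]⟩
    exact hconn.subset_connectedComponentIn h1 hsub hz'
  · intro z hz
    have hsub : connectedComponentIn ({z : ℂ | 0 ≤ z.im} \ closure K) 1 ⊆ K.mirrorClosureᶜ := by
      intro w hw
      have hw' := connectedComponentIn_subset _ _ hw
      rw [mem_compl_iff, K.mem_mirrorClosure_iff_of_im_nonneg hw'.1]
      exact hw'.2
    have h1 : (1 : ℂ) ∈ {z : ℂ | 0 ≤ z.im} \ closure (K : Set ℂ) :=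
      ⟨by simp, fun h ↦ K.one_notMem_mirrorClosure (Or.inl h)⟩
    exact ⟨(isPreconnected_connectedComponentIn.subset_connectedComponentIn
      (mem_connectedComponentIn h1) hsub) hz, (connectedComponentIn_subset _ _ hz).1⟩


/-! ### `Fill₋(cl K)` is connected, and so is its complement in `ℍ` -/

/-- A connected subset of `ℍ̄ ∖ cl K` meeting the right domain lies in it. [folklore] -/
theorem subset_rightDomain_of_isPreconnected {T : Set ℂ} (hT : IsPreconnected T)
    (hTsub : T ⊆ {z : ℂ | 0 ≤ z.im} \ closure K) {w : ℂ} (hwT : w ∈ T) (hw : w ∈ K.rightDomain) :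
    T ⊆ K.rightDomain := by
  have hw' : w ∈ connectedComponentIn ({z : ℂ | 0 ≤ z.im} \ closure K) 1 := by
    rw [← K.rightDomain_inter_eq]
    exact ⟨hw, (hTsub hwT).1⟩
  intro z hz
  have h := hT.subset_connectedComponentIn hwT hTsub hz
  rw [← connectedComponentIn_eq hw'] at h
  rw [← K.rightDomain_inter_eq] at h
  exact h.1

/-- **`Fill₋(cl K)` is connected**: it is the connected set `cl K` together with the other
components of `ℍ̄ ∖ cl K`, none of which can be split off (a piece of `Fill₋(cl K) ∖ cl K`
closed in `ℂ` and missing `cl K` would be relatively open in the connected `ℍ̄`).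
[cite: LawlerSchrammWerner2003Restriction, §8.1 p. 31 (Ω₊: closed connected sets)] -/
theorem isConnected_leftFill : IsConnected K.leftFill := by
  refine ⟨⟨0, K.closure_subset_leftFill K.zero_mem_closure⟩, ?_⟩
  rw [isPreconnected_iff_subset_of_disjoint_closed]
  intro u v hu hv hcover hdisj
  set F : Set ℂ := closure (K : Set ℂ) with hF
  set H : Set ℂ := {z : ℂ | 0 ≤ z.im} with hH
  have hHconn : IsPreconnected H := (convex_halfSpace_im_ge (0 : ℝ)).isPreconnected
  -- `cl K` is connected, so it lies in `u` or in `v`; by symmetry in `u`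
  have hFuv : F ⊆ u ∨ F ⊆ v := by
    refine isPreconnected_iff_subset_of_disjoint_closed.1 K.isConnected_closure.isPreconnected u v
      hu hv (K.closure_subset_leftFill.trans hcover) ?_
    rw [← subset_empty_iff, ← hdisj]
    exact inter_subset_inter_left _ K.closure_subset_leftFill
  wlog hFu : F ⊆ u generalizing u v
  · exact (this v u hv hu (by rwa [union_comm v u]) (by rwa [inter_comm v u]) hFuv.symm
      (hFuv.resolve_left hFu)).symm
  left
  -- the piece `Y = Fill₋ ∩ v` is closed, misses `u ⊇ cl K`, and is relatively open in `ℍ̄`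
  set Y : Set ℂ := K.leftFill ∩ v with hY
  have hYc : IsClosed Y := K.isClosed_leftFill.inter hv
  have hYu : ∀ y ∈ Y, y ∉ u := fun y hy hyu ↦ by
    have : y ∈ K.leftFill ∩ (u ∩ v) := ⟨hy.1, hyu, hy.2⟩
    rw [hdisj] at this
    exact this
  have hYopen : ∀ y ∈ Y, ∃ r > 0, ball y r ∩ H ⊆ Y := by
    intro y hy
    have hyF : y ∉ F := fun h ↦ hYu y hy (hFu h)
    obtain ⟨r, hr, hrsub⟩ := Metric.isOpen_iff.1 (hu.union isClosed_closure).isOpen_compl y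
      (fun h ↦ h.elim (hYu y hy) hyF)
    refine ⟨r, hr, fun w hw ↦ ?_⟩
    have hwu : w ∉ u := fun h ↦ hrsub hw.1 (Or.inl h)
    -- `w ∉ rightDomain K`: otherwise the convex set `ball y r ∩ ℍ̄ ⊆ ℍ̄ ∖ cl K` would lie in it
    have hwR : w ∉ K.rightDomain := fun hwR ↦ by
      have hsub : ball y r ∩ H ⊆ K.rightDomain :=
        K.subset_rightDomain_of_isPreconnected
          ((convex_ball y r).inter (convex_halfSpace_im_ge (0 : ℝ))).isPreconnected
          (fun z hz ↦ ⟨hz.2, fun h ↦ hrsub hz.1 (Or.inr h)⟩) hw hwR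
      exact hy.1.2 (hsub ⟨mem_ball_self hr, hy.1.1⟩)
    have hwL : w ∈ K.leftFill := ⟨hw.2, hwR⟩
    exact ⟨hwL, (hcover hwL).resolve_left hwu⟩
  -- so `Y = ∅` by connectedness of `ℍ̄` (`1 ∈ ℍ̄ ∖ Y`)
  have hYempty : Y = ∅ := by
    by_contra hne
    obtain ⟨y, hy⟩ := nonempty_iff_ne_empty.2 hne
    choose! r hr hrY using hYopen
    set O : Set ℂ := ⋃ y ∈ Y, ball y (r y) with hO
    have hOo : IsOpen O := isOpen_biUnion fun _ _ ↦ isOpen_ball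
    have h1 : (1 : ℂ) ∈ H ∩ Yᶜ := ⟨by simp [hH], fun h ↦ h.1.2 K.one_mem_rightDomain⟩
    obtain ⟨z, hzH, hzO, hzY⟩ := hHconn O Yᶜ hOo hYc.isOpen_compl
      (fun z hz ↦ by
        by_cases hzY : z ∈ Y
        · exact Or.inl (mem_biUnion hzY (mem_ball_self (hr z hzY)))
        · exact Or.inr hzY)
      ⟨y, hy.1.1, mem_biUnion hy (mem_ball_self (hr y hy))⟩ ⟨1, h1⟩
    rw [hO, mem_iUnion₂] at hzO
    obtain ⟨y', hy', hzy'⟩ := hzO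
    exact hzY (hrY y' hy' ⟨hzy', hzH⟩)
  intro z hz
  rcases hcover hz with h | h
  · exact h
  · have : z ∈ Y := ⟨hz, h⟩
    rw [hYempty] at this
    exact absurd this (notMem_empty _)

/-- `ℍ ∖ Fill₋(cl K) = ℍ ∩ rightDomain K`. [folklore] -/
theorem upperHalfPlaneSet_diff_leftFill :
    upperHalfPlaneSet \ K.leftFill = upperHalfPlaneSet ∩ K.rightDomain := by
  ext z
  constructor
  · rintro ⟨hz, h⟩
    refine ⟨hz, ?_⟩
    by_contra h'
    exact h ⟨le_of_lt (show 0 < z.im from hz), h'⟩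
  · rintro ⟨hz, h⟩
    exact ⟨hz, fun h' ↦ h'.2 h⟩

/-- The fold maps the right domain into itself (it is symmetric under conjugation). [folklore] -/
theorem foldUp_mem_rightDomain {z : ℂ} (hz : z ∈ K.rightDomain) : Literature.Topology.PlaneTopology.foldUp z ∈ K.rightDomain := by
  rcases Literature.Topology.PlaneTopology.foldUp_eq_or z with h | h
  · rwa [h]
  · rw [h]
    exact K.conj_mem_rightDomain_iff.2 hz

/-- **`ℍ ∖ Fill₋(cl K)` is connected** ([LSW] §8.1: `ℍ ∖ K` connected for `K ∈ Ω₊`): two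
points of `ℍ ∩ rightDomain K` are joined inside the open connected `rightDomain K`; fold the
path into `ℍ̄` (the domain is symmetric) and lift it off the real axis by a small `iη`.
[cite: LawlerSchrammWerner2003Restriction, §8.1 p. 31 (Ω₊: ℍ ∖ K connected)] -/
theorem isConnected_upperHalfPlaneSet_diff_leftFill : IsConnected (upperHalfPlaneSet \ K.leftFill) := by
  rw [K.upperHalfPlaneSet_diff_leftFill]
  set M : Set ℂ := upperHalfPlaneSet ∩ K.rightDomain with hM
  have hMopen : IsOpen M := UpperHalfPlane.isOpen_upperHalfPlaneSet.inter K.isOpen_rightDomain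
  have hpath : IsPathConnected K.rightDomain :=
    K.isOpen_rightDomain.isConnected_iff_isPathConnected.1 K.isConnected_rightDomain
  have hjoin : ∀ x ∈ M, ∀ y ∈ M, JoinedIn M x y := by
    intro x hx y hy
    have hxim : 0 < x.im := hx.1
    have hyim : 0 < y.im := hy.1
    obtain ⟨p, hp⟩ := hpath.joinedIn x hx.2 y hy.2
    -- the folded path stays in the (symmetric) right domain, at positive distance from its complement
    set C : Set ℂ := range (Literature.Topology.PlaneTopology.foldUp ∘ p) with hC
    have hCc : IsCompact C := isCompact_range (Literature.Topology.PlaneTopology.continuous_foldUp.comp p.continuous)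
    have hCR : C ⊆ K.rightDomain := by
      rintro _ ⟨t, rfl⟩
      exact K.foldUp_mem_rightDomain (hp t)
    obtain ⟨δ, hδ, hδC⟩ := hCc.exists_thickening_subset_open K.isOpen_rightDomain hCR
    obtain ⟨ρx, hρx, hρxM⟩ := Metric.isOpen_iff.1 hMopen x hx
    obtain ⟨ρy, hρy, hρyM⟩ := Metric.isOpen_iff.1 hMopen y hy
    set η : ℝ := min (δ / 2) (min (ρx / 2) (ρy / 2)) with hη
    have hη0 : 0 < η := by positivity
    have hηδ : η < δ := (min_le_left _ _).trans_lt (half_lt_self hδ)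
    have hηx : η < ρx := ((min_le_right _ _).trans (min_le_left _ _)).trans_lt (half_lt_self hρx)
    have hηy : η < ρy := ((min_le_right _ _).trans (min_le_right _ _)).trans_lt (half_lt_self hρy)
    have hshift : ∀ z : ℂ, dist (z + η * I) z = η := fun z ↦ by
      rw [dist_eq_norm, add_sub_cancel_left, norm_mul, Complex.norm_real, Complex.norm_I, mul_one,
        Real.norm_eq_abs, abs_of_pos hη0]
    have h1 : JoinedIn M x (x + η * I) := by
      refine JoinedIn.of_segment_subset (((convex_ball x ρx).segment_subset ?_ ?_).trans hρxM)
      · exact mem_ball_self hρx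
      · rw [mem_ball, hshift]
        exact hηx
    have h3 : JoinedIn M (y + η * I) y := by
      refine JoinedIn.of_segment_subset (((convex_ball y ρy).segment_subset ?_ ?_).trans hρyM)
      · rw [mem_ball, hshift]
        exact hηy
      · exact mem_ball_self hρy
    have h2 : JoinedIn M (x + η * I) (y + η * I) := by
      let q : Path (x + η * I) (y + η * I) :=
        { toFun := fun t ↦ Literature.Topology.PlaneTopology.foldUp (p t) + η * I
          continuous_toFun := (Literature.Topology.PlaneTopology.continuous_foldUp.comp p.continuous).add continuous_const
          source' := by simp [Literature.Topology.PlaneTopology.foldUp_of_nonneg hxim.le]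
          target' := by simp [Literature.Topology.PlaneTopology.foldUp_of_nonneg hyim.le] }
      refine ⟨q, fun t ↦ ⟨?_, ?_⟩⟩
      · show 0 < (Literature.Topology.PlaneTopology.foldUp (p t) + η * I).im
        simp only [Complex.add_im, Literature.Topology.PlaneTopology.foldUp_im, Complex.mul_im, Complex.ofReal_re, Complex.I_im,
          mul_one, Complex.ofReal_im, Complex.I_re, mul_zero, add_zero]
        positivity
      · show Literature.Topology.PlaneTopology.foldUp (p t) + η * I ∈ K.rightDomain
        have : Literature.Topology.PlaneTopology.foldUp (p t) + ↑η * I ∈ thickening δ C :=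
          Metric.mem_thickening_iff.2 ⟨Literature.Topology.PlaneTopology.foldUp (p t), ⟨t, rfl⟩, by rw [hshift]; exact hηδ⟩
        exact hδC this
    exact (h1.trans h2).trans h3
  -- a point of `M`: just above `1`
  obtain ⟨r, hr, hrR⟩ := Metric.isOpen_iff.1 K.isOpen_rightDomain 1 K.one_mem_rightDomain
  have hz₀ : (1 : ℂ) + ((r / 2 : ℝ) : ℂ) * I ∈ M := by
    refine ⟨?_, hrR ?_⟩
    · show 0 < ((1 : ℂ) + ((r / 2 : ℝ) : ℂ) * I).im
      simp only [Complex.add_im, Complex.one_im, Complex.mul_im, Complex.ofReal_re, Complex.I_im,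
        mul_one, Complex.ofReal_im, Complex.I_re, mul_zero, add_zero, zero_add]
      positivity
    · rw [mem_ball, dist_eq_norm, add_sub_cancel_left, norm_mul, Complex.norm_real, Complex.norm_I,
        mul_one, Real.norm_eq_abs, abs_of_pos (by positivity)]
      linarith
  exact IsPathConnected.isConnected ⟨_, hz₀, fun y hy ↦ hjoin _ hz₀ y hy⟩

/-! ### `+`-hulls avoided by `K` are avoided by `Fill₋(cl K)` -/

/-- Points of a bounded hull have nonnegative imaginary part. [folklore] -/
theorem im_nonneg_of_mem_isBoundedHull {A : Set ℂ} (hA : IsBoundedHull A) {z : ℂ} (hz : z ∈ A) :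
    0 ≤ z.im := by
  have h := hA.subset_closure hz
  rw [Complex.closure_setOf_lt_im] at h
  exact h

/-- **A `+`-hull together with the positive real axis is connected**: every piece of
`A ∈ 𝒬₊` is attached to the real line (`IsBoundedHull.isConnected_union_im_nonpos`) at
positive points (`A ∩ ℝ ⊆ (0, ∞)`). [cite: LawlerSchrammWerner2003Restriction, §2 p. 8 (𝒬₊: A ∩ ℝ ⊆ (0, ∞))] -/
theorem _root_.Literature.Probability.RandomPlanarGeometry.IsPlusHull.isPreconnected_union_ofReal_Ioi {A : Set ℂ} (hA : IsPlusHull A) :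
    IsPreconnected (A ∪ ((↑) : ℝ → ℂ) '' Ioi 0) := by
  set P : Set ℂ := ((↑) : ℝ → ℂ) '' Ioi 0 with hP
  set L : Set ℂ := {z : ℂ | z.im ≤ 0} with hL
  have hPconn : IsPreconnected P := isPreconnected_Ioi.image _ Complex.continuous_ofReal.continuousOn
  have hT := hA.1.isBoundedHull.isConnected_union_im_nonpos
  have hAc : IsCompact A := hA.1.isBoundedHull.isCompact
  rw [isPreconnected_iff_subset_of_disjoint_closed]
  intro u v hu hv hcover hdisj
  have hPuv : P ⊆ u ∨ P ⊆ v := by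
    refine isPreconnected_iff_subset_of_disjoint_closed.1 hPconn u v hu hv
      (subset_union_right.trans hcover) ?_
    rw [← subset_empty_iff, ← hdisj]
    exact inter_subset_inter_left _ subset_union_right
  wlog hPu : P ⊆ u generalizing u v
  · exact (this v u hv hu (by rwa [union_comm v u]) (by rwa [inter_comm v u]) hPuv.symm
      (hPuv.resolve_left hPu)).symm
  left
  -- `Y = A ∩ v` is compact, misses `u ⊇ P ⊇ A ∩ ℝ`, hence floats in `ℍ`
  set Y : Set ℂ := A ∩ v with hY
  have hYu : ∀ y ∈ Y, y ∉ u := fun y hy hyu ↦ by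
    have : y ∈ (A ∪ P) ∩ (u ∩ v) := ⟨Or.inl hy.1, hyu, hy.2⟩
    rw [hdisj] at this
    exact this
  have hYim : ∀ y ∈ Y, 0 < y.im := fun y hy ↦ by
    rcases (im_nonneg_of_mem_isBoundedHull hA.1.isBoundedHull hy.1).lt_or_eq with h | h
    · exact h
    · exfalso
      have hyreal : y = ((y.re : ℝ) : ℂ) := Complex.ext (by simp) (by simp [← h])
      have hpos := hA.2 y.re (hyreal ▸ hy.1)
      exact hYu y hy (hPu ⟨y.re, hpos, hyreal.symm⟩)
  -- `A ∪ L` is covered by the disjoint closed sets `(A ∩ u) ∪ L` and `Y`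
  have hYc : IsClosed Y := hAc.isClosed.inter hv
  have hXc : IsClosed (A ∩ u ∪ L) := (hAc.isClosed.inter hu).union (isClosed_le Complex.continuous_im continuous_const)
  have hcov : A ∪ L ⊆ (A ∩ u ∪ L) ∪ Y := by
    rintro z (hz | hz)
    · rcases hcover (Or.inl hz) with h | h
      · exact Or.inl (Or.inl ⟨hz, h⟩)
      · exact Or.inr ⟨hz, h⟩
    · exact Or.inl (Or.inr hz)
  have hdis : (A ∪ L) ∩ ((A ∩ u ∪ L) ∩ Y) = ∅ := by
    ext z
    simp only [mem_inter_iff, mem_empty_iff_false, iff_false, not_and]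
    rintro - (hzu | hzL) hzY
    · exact hYu z hzY hzu.2
    · exact absurd hzL (not_le.2 (hYim z hzY))
  rcases isPreconnected_iff_subset_of_disjoint_closed.1 hT.isPreconnected _ _ hXc hYc hcov hdis with h | h
  · -- `Y = ∅`, so `A ⊆ u`
    refine union_subset (fun a ha ↦ ?_) hPu
    rcases hcover (Or.inl ha) with hau | hav
    · exact hau
    · rcases h (Or.inl ha) with h' | h'
      · exact h'.2
      · exact absurd h' (not_le.2 (hYim a ⟨ha, hav⟩))
  · exact absurd (h (Or.inr (show (0 : ℂ) ∈ L by simp [hL]))).2 (fun h0 ↦ by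
      have := hYim 0 ⟨(h (Or.inr (show (0 : ℂ) ∈ L by simp [hL]))).1, h0⟩
      simp at this)

/-- **A `+`-hull avoided by `K` lies in the right domain**: `A ∪ (0, ∞)` is connected, misses
`F*` (`A ∩ cl K = ∅` as `0 ∉ A`; `A ⊆ ℍ̄`), and passes through `1`. [cite: LawlerSchrammWerner2003Restriction, §8.1 p. 31 (F^{ℝ₊}_ℍ of a sample of P_α)] -/
theorem subset_rightDomain_of_disjoint {A : Set ℂ} (hA : IsPlusHull A) (hKA : Disjoint (K : Set ℂ) A) :
    A ⊆ K.rightDomain := by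
  have hsub : A ∪ ((↑) : ℝ → ℂ) '' Ioi 0 ⊆ K.mirrorClosureᶜ := by
    rintro z (hz | ⟨x, hx, rfl⟩)
    · rw [mem_compl_iff, K.mem_mirrorClosure_iff_of_im_nonneg (im_nonneg_of_mem_isBoundedHull hA.1.isBoundedHull hz)]
      exact fun h ↦ Set.disjoint_left.1 (K.disjoint_closure_of_disjoint hA.1.zero_notMem hKA) h hz
    · exact K.ofReal_notMem_mirrorClosure (ne_of_gt hx)
  have h1 : (1 : ℂ) ∈ A ∪ ((↑) : ℝ → ℂ) '' Ioi 0 := Or.inr ⟨1, mem_Ioi.2 zero_lt_one, by simp⟩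
  exact subset_union_left.trans (hA.isPreconnected_union_ofReal_Ioi.subset_connectedComponentIn h1 hsub)

/-- **`Fill₋(cl K) ∩ A = ∅ ⟺ K ∩ A = ∅` for `A ∈ 𝒬₊`** ([LSW] §8.1: the avoidance events of
`+`-hulls for `Fill₋` of a sample of `P_α` are those of the sample). [cite: LawlerSchrammWerner2003Restriction, §8.1 p. 31] -/
theorem disjoint_leftFill_iff {A : Set ℂ} (hA : IsPlusHull A) :
    Disjoint K.leftFill A ↔ Disjoint (K : Set ℂ) A := by
  refine ⟨fun h ↦ h.mono_left K.subset_leftFill, fun h ↦ ?_⟩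
  exact Set.disjoint_left.2 fun z hz hzA ↦ hz.2 (K.subset_rightDomain_of_disjoint hA h hzA)

end RestrictionConfig

end Literature.Probability.RandomPlanarGeometry

end
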